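import Literature.Probability.Percolation.KSTPeriodicQuasiWalls
import Literature.Probability.Percolation.KSTPeriodicWeak
import HarnessLib

/-!
# KST-type RSW for periodic measures: Lemma 3, arms give quasi-crossings

Topic `Literature/Probability/Percolation`. Proof of [KohlerSchindlerTassion2023, Lemma 3 and
Comment 1] in the constant form `QuasiOfArms` of `KSTPeriodicStatements.lean`: arm bounds `≥ a₀`
at all large scales divisible by `64k` give `μ(𝓠(4m, m)) ≥ a₀ ^ 6` at all large scales `m`
divisible by `1536k`, for admissible measures carried by lattice configurations, granted the
planar facts `TopSideToLeftMeetsTB`, `TopSideToRightMeetsTB`, `AlternatingTBMeet` and the corridor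
lemma `CorridorA`.

Construction (`m = 1536p`, big box `R_t(5m + k, 4m)`, `H = R_t(m + m/12, m)`): two arms of scale
`m` translated by `∓96p e₀` (the *fences*, inside `H`), two arms of scale `3840p = 5m/2`
translated by `±2304p e₁` (from the top, resp. bottom, row of the big box to the bottom, resp.
top, row of `H`, feet strictly between the fences), and two transposed arms of scale
`5952p = 31m/8` translated by `∓1729p e₀` (left–right crossings of the two overlapping halves
`[-(5m+k)-t, 3900p] × [-4m-t, 4m]` and `[-3900p-t, 5m+k] × [-4m-t, 4m]` of the big box). All six
are images of arm events under symmetries of the measure, hence have probability `≥ a₀`; on their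
intersection `quasiSides_of_arms` (`KSTPeriodicQuasiWalls.lean`) realises the quasi-crossing, and
positive association gives the bound `a₀ ^ 6`.

## References

* [KohlerSchindlerTassion2023] L. Köhler-Schindler, V. Tassion, *Crossing probabilities for
  planar percolation*, Duke Math. J. 172 (2023) 809–838, §4.2 (Lemma 3); Comment 1.
-/

namespace Literature.Probability.Percolation

open LatticeModels SimpleGraph _root_.MeasureTheory

noncomputable section

namespace KSTPeriodic

/-! ### Translated arms in coordinates -/

/-- Membership in the transpose of a set of sites. [folklore] -/
theorem mem_image_transposeEquiv {A : Set (Site 2)} {x : Site 2} :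
    x ∈ transposeEquiv '' A ↔ (![x 1, x 0] : Site 2) ∈ A := by
  constructor
  · rintro ⟨y, hy, rfl⟩
    have : (![y 0, y 1] : Site 2) = y := by ext i; fin_cases i <;> simp
    simpa [transposeEquiv_apply, this] using hy
  · intro h
    exact ⟨![x 1, x 0], h, by ext i; fin_cases i <;> simp⟩

/-- The endpoints and the box of a translated arm event, in coordinates. [folklore] -/
theorem exists_of_mem_shift_arm {ω : BondConfig (Site 2)} {w : Site 2} {a b c d : ℤ} {t α : ℕ}
    {n n' : ℤ} (h : ω ∈ openCrossing (Site.shift w '' rect a b c d)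
      (Site.shift w '' upperTarget t α n) (Site.shift w '' upperTarget t α n')) :
    ∃ g h' : Site 2, ω ∈ openConnIn (rect (a + w 0) (b + w 0) (c + w 1) (d + w 1)) g h' ∧
      (-(α : ℤ) - t + w 0 ≤ g 0 ∧ g 0 ≤ α + w 0 ∧ g 1 = n + w 1) ∧
      (-(α : ℤ) - t + w 0 ≤ h' 0 ∧ h' 0 ≤ α + w 0 ∧ h' 1 = n' + w 1) := by
  obtain ⟨g, hg, h', hh', hc⟩ := h
  rw [image_shift_rect] at hc
  rw [mem_image_shift_iff, mem_upperTarget] at hg hh'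
  simp only [Pi.sub_apply] at hg hh'
  exact ⟨g, h', hc, ⟨by omega, by omega, by omega⟩, ⟨by omega, by omega, by omega⟩⟩

/-- The endpoints and the box of a translated transposed arm event, in coordinates: a connection
between two columns. [folklore] -/
theorem exists_of_mem_shift_transpose_arm {ω : BondConfig (Site 2)} {w : Site 2} {a b c d : ℤ}
    {t α : ℕ} {n n' : ℤ} (h : ω ∈ openCrossing (Site.shift w '' (transposeEquiv '' rect a b c d))
      (Site.shift w '' (transposeEquiv '' upperTarget t α n))
      (Site.shift w '' (transposeEquiv '' upperTarget t α n'))) :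
    ∃ g h' : Site 2, ω ∈ openConnIn (rect (c + w 0) (d + w 0) (a + w 1) (b + w 1)) g h' ∧
      g 0 = n + w 0 ∧ h' 0 = n' + w 0 := by
  obtain ⟨g, hg, h', hh', hc⟩ := h
  rw [image_transpose_rect, image_shift_rect] at hc
  rw [mem_image_shift_iff, mem_image_transposeEquiv, mem_upperTarget] at hg hh'
  simp only [Matrix.cons_val_one, Matrix.cons_val_zero, Pi.sub_apply] at hg hh'
  exact ⟨g, h', hc, by omega, by omega⟩

/-! ### The six events, in the format of `quasiSides_of_arms`

Throughout `m = 1536p` is the scale, `t` the parity offset, `k ≤ p`; the fences are the arms of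
scale `m` (target half-width `m/64 = 24p`) translated by `∓96p e₀`, the long arms have scale
`n₂ = 3840p` and are translated by `±2304p e₁`, the crossers are transposed arms of scale
`n₃ = 5952p` translated by `∓1729p e₀`. -/

/-- The left fence: an open connection inside `H = R_t(m + m/12, m)` between its targets, with
endpoints at abscissae in `[-m/12 - t, -72p]`. [cite: KohlerSchindlerTassion2023, §4.2, proof of Lemma 3] -/
theorem fenceLeft_of_event {ω : BondConfig (Site 2)} {m p t : ℕ} (hm : m = 1536 * p)
    (h : ω ∈ openCrossing
      (Site.shift ((p : ℤ) • ![-96, 0]) '' rect (-((m : ℤ) + (m / 64 : ℕ)) - t) (m + (m / 64 : ℕ)) (-(m : ℤ) - t) m)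
      (Site.shift ((p : ℤ) • ![-96, 0]) '' upperTarget t (m / 64) m)
      (Site.shift ((p : ℤ) • ![-96, 0]) '' upperTarget t (m / 64) (-(m : ℤ) - t))) :
    ∃ g h : Site 2, ω ∈ openConnIn (mRegion t (m / 12) m) g h ∧ g 1 = m ∧ h 1 = -(m : ℤ) - t ∧
      -((m / 12 : ℕ) : ℤ) - t ≤ g 0 ∧ g 0 ≤ -(72 * (p : ℤ)) ∧
      -((m / 12 : ℕ) : ℤ) - t ≤ h 0 ∧ h 0 ≤ -(72 * (p : ℤ)) := by
  obtain ⟨g, h', hc, hg, hh'⟩ := exists_of_mem_shift_arm h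
  simp only [Pi.smul_apply, smul_eq_mul, Matrix.cons_val_zero, Matrix.cons_val_one, mul_zero,
    add_zero, mul_neg] at hc hg hh'
  refine ⟨g, h', openConnIn_mono (fun z hz => ?_) _ _ hc, ?_, ?_, ?_, ?_, ?_, ?_⟩
  · simp only [mRegion, mem_rect] at hz ⊢; push_cast at hz ⊢; omega
  all_goals push_cast at hg hh' ⊢; omega

/-- The right fence: an open connection inside `H` between its targets, with endpoints at
abscissae in `[72p - t, m/12]`. [cite: KohlerSchindlerTassion2023, §4.2, proof of Lemma 3] -/
theorem fenceRight_of_event {ω : BondConfig (Site 2)} {m p t : ℕ} (hm : m = 1536 * p)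
    (h : ω ∈ openCrossing
      (Site.shift ((p : ℤ) • ![96, 0]) '' rect (-((m : ℤ) + (m / 64 : ℕ)) - t) (m + (m / 64 : ℕ)) (-(m : ℤ) - t) m)
      (Site.shift ((p : ℤ) • ![96, 0]) '' upperTarget t (m / 64) m)
      (Site.shift ((p : ℤ) • ![96, 0]) '' upperTarget t (m / 64) (-(m : ℤ) - t))) :
    ∃ g h : Site 2, ω ∈ openConnIn (mRegion t (m / 12) m) g h ∧ g 1 = m ∧ h 1 = -(m : ℤ) - t ∧
      72 * (p : ℤ) - t ≤ g 0 ∧ g 0 ≤ ((m / 12 : ℕ) : ℤ) ∧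
      72 * (p : ℤ) - t ≤ h 0 ∧ h 0 ≤ ((m / 12 : ℕ) : ℤ) := by
  obtain ⟨g, h', hc, hg, hh'⟩ := exists_of_mem_shift_arm h
  simp only [Pi.smul_apply, smul_eq_mul, Matrix.cons_val_zero, Matrix.cons_val_one, mul_zero,
    add_zero] at hc hg hh'
  refine ⟨g, h', openConnIn_mono (fun z hz => ?_) _ _ hc, ?_, ?_, ?_, ?_, ?_, ?_⟩
  · simp only [mRegion, mem_rect] at hz ⊢; push_cast at hz ⊢; omega
  all_goals push_cast at hg hh' ⊢; omega

/-- The long arm from the top row `4m` of the big box down to the bottom row of `H`, inside the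
columns `[-3900p - t, 3900p]`, with foot at abscissa in `(-72p, 72p - t)`.
[cite: KohlerSchindlerTassion2023, §4.2, proof of Lemma 3] -/
theorem longArmTop_of_event {ω : BondConfig (Site 2)} {m p t n₂ : ℕ} (hm : m = 1536 * p)
    (hn : n₂ = 3840 * p) (htp : t < 12 * p)
    (h : ω ∈ openCrossing
      (Site.shift ((p : ℤ) • ![0, 2304]) '' rect (-((n₂ : ℤ) + (n₂ / 64 : ℕ)) - t) (n₂ + (n₂ / 64 : ℕ)) (-(n₂ : ℤ) - t) n₂)
      (Site.shift ((p : ℤ) • ![0, 2304]) '' upperTarget t (n₂ / 64) n₂)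
      (Site.shift ((p : ℤ) • ![0, 2304]) '' upperTarget t (n₂ / 64) (-(n₂ : ℤ) - t))) :
    ∃ x y : Site 2, ω ∈ openConnIn (rect (-(3900 * (p : ℤ)) - t) (3900 * p) (-(m : ℤ) - t)
      ((4 * m : ℕ) : ℤ)) x y ∧ x 1 = ((4 * m : ℕ) : ℤ) ∧ y 1 = -(m : ℤ) - t ∧
      -(72 * (p : ℤ)) < y 0 ∧ y 0 < 72 * (p : ℤ) - t := by
  obtain ⟨g, h', hc, hg, hh'⟩ := exists_of_mem_shift_arm h
  simp only [Pi.smul_apply, smul_eq_mul, Matrix.cons_val_zero, Matrix.cons_val_one, mul_zero,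
    add_zero] at hc hg hh'
  refine ⟨g, h', openConnIn_mono (fun z hz => ?_) _ _ hc, ?_, ?_, ?_, ?_⟩
  · simp only [mem_rect] at hz ⊢; push_cast at hz ⊢; omega
  all_goals push_cast at hg hh' ⊢; omega

/-- The long arm from the top row of `H` down to the bottom row `-4m - t` of the big box, inside
the columns `[-3900p - t, 3900p]`, with top at abscissa in `(-72p, 72p - t)`.
[cite: KohlerSchindlerTassion2023, §4.2, proof of Lemma 3] -/
theorem longArmBot_of_event {ω : BondConfig (Site 2)} {m p t n₂ : ℕ} (hm : m = 1536 * p)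
    (hn : n₂ = 3840 * p) (htp : t < 12 * p)
    (h : ω ∈ openCrossing
      (Site.shift ((p : ℤ) • ![0, -2304]) '' rect (-((n₂ : ℤ) + (n₂ / 64 : ℕ)) - t) (n₂ + (n₂ / 64 : ℕ)) (-(n₂ : ℤ) - t) n₂)
      (Site.shift ((p : ℤ) • ![0, -2304]) '' upperTarget t (n₂ / 64) n₂)
      (Site.shift ((p : ℤ) • ![0, -2304]) '' upperTarget t (n₂ / 64) (-(n₂ : ℤ) - t))) :
    ∃ x y : Site 2, ω ∈ openConnIn (rect (-(3900 * (p : ℤ)) - t) (3900 * p) (-((4 * m : ℕ) : ℤ) - t) m)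
      x y ∧ x 1 = m ∧ y 1 = -((4 * m : ℕ) : ℤ) - t ∧ -(72 * (p : ℤ)) < x 0 ∧ x 0 < 72 * (p : ℤ) - t := by
  obtain ⟨g, h', hc, hg, hh'⟩ := exists_of_mem_shift_arm h
  simp only [Pi.smul_apply, smul_eq_mul, Matrix.cons_val_zero, Matrix.cons_val_one, mul_zero,
    add_zero, mul_neg] at hc hg hh'
  refine ⟨g, h', openConnIn_mono (fun z hz => ?_) _ _ hc, ?_, ?_, ?_, ?_⟩
  · simp only [mem_rect] at hz ⊢; push_cast at hz ⊢; omega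
  all_goals push_cast at hg hh' ⊢; omega

/-- The left crosser: an open left–right crossing of the left half
`[-(5m + k) - t, 3900p] × [-4m - t, 4m]` of the big box, cut out of the translated transposed
arm (a left–right crossing of `[-7681p - t, 4223p] × [-6045p - t, 6045p]`).
[cite: KohlerSchindlerTassion2023, §4.2, proof of Lemma 3] -/
theorem crosserLeft_of_event {ω : BondConfig (Site 2)} (hω : ω ⊆ (zdGraph 2).edgeSet)
    {m p t k n₃ : ℕ} (hm : m = 1536 * p) (hn : n₃ = 5952 * p) (hkp : k ≤ p)
    (h : ω ∈ openCrossing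
      (Site.shift ((p : ℤ) • ![-1729, 0]) ''
        (transposeEquiv '' rect (-((n₃ : ℤ) + (n₃ / 64 : ℕ)) - t) (n₃ + (n₃ / 64 : ℕ)) (-(n₃ : ℤ) - t) n₃))
      (Site.shift ((p : ℤ) • ![-1729, 0]) '' (transposeEquiv '' upperTarget t (n₃ / 64) n₃))
      (Site.shift ((p : ℤ) • ![-1729, 0]) '' (transposeEquiv '' upperTarget t (n₃ / 64) (-(n₃ : ℤ) - t)))) :
    ∃ x y : Site 2, ω ∈ openConnIn (rect (-(((4 * m : ℕ) : ℤ) + ((m + k : ℕ) : ℤ)) - t) (3900 * p)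
      (-((4 * m : ℕ) : ℤ) - t) ((4 * m : ℕ) : ℤ)) x y ∧
      x 0 = -(((4 * m : ℕ) : ℤ) + ((m + k : ℕ) : ℤ)) - t ∧ y 0 = 3900 * p := by
  obtain ⟨g, h', hc, hg, hh'⟩ := exists_of_mem_shift_transpose_arm h
  simp only [Pi.smul_apply, smul_eq_mul, Matrix.cons_val_zero, Matrix.cons_val_one, mul_zero,
    add_zero, mul_neg] at hc hg hh'
  have hc' : ω ∈ openConnIn (rect (-(7681 * (p : ℤ)) - t) (4223 * p) (-(6045 * (p : ℤ)) - t) (6045 * p))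
      h' g := by
    rw [openConnIn_comm]
    refine openConnIn_mono (fun z hz => ?_) _ _ hc
    simp only [mem_rect] at hz ⊢; push_cast at hz ⊢; omega
  have hLR : ω ∈ lrRect (-(7681 * (p : ℤ)) - t) (4223 * p) (-(6045 * (p : ℤ)) - t) (6045 * p) :=
    ⟨h', ⟨hc'.1, by omega⟩, g, ⟨hc'.2.1, by omega⟩, hc'⟩
  have hkp' : (k : ℤ) ≤ p := by exact_mod_cast hkp
  obtain ⟨x, ⟨-, hx0⟩, y, ⟨-, hy0⟩, hxy⟩ := lrRect_subset_lrRect hω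
    (a' := -(((4 * m : ℕ) : ℤ) + ((m + k : ℕ) : ℤ)) - t) (b' := 3900 * (p : ℤ))
    (c' := -((4 * m : ℕ) : ℤ) - t) (d' := ((4 * m : ℕ) : ℤ)) (by push_cast; omega) (by push_cast; omega)
    (by omega) (by push_cast; omega) (by push_cast; omega) hLR
  exact ⟨x, y, hxy, hx0, hy0⟩

/-- The right crosser: an open left–right crossing of the right half
`[-3900p - t, 5m + k] × [-4m - t, 4m]` of the big box.
[cite: KohlerSchindlerTassion2023, §4.2, proof of Lemma 3] -/
theorem crosserRight_of_event {ω : BondConfig (Site 2)} (hω : ω ⊆ (zdGraph 2).edgeSet)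
    {m p t k n₃ : ℕ} (hm : m = 1536 * p) (hn : n₃ = 5952 * p) (hkp : k ≤ p)
    (h : ω ∈ openCrossing
      (Site.shift ((p : ℤ) • ![1729, 0]) ''
        (transposeEquiv '' rect (-((n₃ : ℤ) + (n₃ / 64 : ℕ)) - t) (n₃ + (n₃ / 64 : ℕ)) (-(n₃ : ℤ) - t) n₃))
      (Site.shift ((p : ℤ) • ![1729, 0]) '' (transposeEquiv '' upperTarget t (n₃ / 64) n₃))
      (Site.shift ((p : ℤ) • ![1729, 0]) '' (transposeEquiv '' upperTarget t (n₃ / 64) (-(n₃ : ℤ) - t)))) :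
    ∃ x y : Site 2, ω ∈ openConnIn (rect (-(3900 * (p : ℤ)) - t) (((4 * m : ℕ) : ℤ) + ((m + k : ℕ) : ℤ))
      (-((4 * m : ℕ) : ℤ) - t) ((4 * m : ℕ) : ℤ)) x y ∧
      x 0 = -(3900 * (p : ℤ)) - t ∧ y 0 = ((4 * m : ℕ) : ℤ) + ((m + k : ℕ) : ℤ) := by
  obtain ⟨g, h', hc, hg, hh'⟩ := exists_of_mem_shift_transpose_arm h
  simp only [Pi.smul_apply, smul_eq_mul, Matrix.cons_val_zero, Matrix.cons_val_one, mul_zero,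
    add_zero] at hc hg hh'
  have hc' : ω ∈ openConnIn (rect (-(4223 * (p : ℤ)) - t) (7681 * p) (-(6045 * (p : ℤ)) - t) (6045 * p))
      h' g := by
    rw [openConnIn_comm]
    refine openConnIn_mono (fun z hz => ?_) _ _ hc
    simp only [mem_rect] at hz ⊢; push_cast at hz ⊢; omega
  have hLR : ω ∈ lrRect (-(4223 * (p : ℤ)) - t) (7681 * p) (-(6045 * (p : ℤ)) - t) (6045 * p) :=
    ⟨h', ⟨hc'.1, by omega⟩, g, ⟨hc'.2.1, by omega⟩, hc'⟩
  have hkp' : (k : ℤ) ≤ p := by exact_mod_cast hkp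
  obtain ⟨x, ⟨-, hx0⟩, y, ⟨-, hy0⟩, hxy⟩ := lrRect_subset_lrRect hω
    (a' := -(3900 * (p : ℤ)) - t) (b' := ((4 * m : ℕ) : ℤ) + ((m + k : ℕ) : ℤ))
    (c' := -((4 * m : ℕ) : ℤ) - t) (d' := ((4 * m : ℕ) : ℤ)) (by omega) (by push_cast; omega)
    (by push_cast; omega) (by push_cast; omega) (by push_cast; omega) hLR
  exact ⟨x, y, hxy, hx0, hy0⟩

/-- **Lemma 3, pathwise, for the six translated arms**: a lattice configuration in all six events
lies in the quasi-crossing `𝓠_t(4m, m)` (big box `R_t(5m + k, 4m)`, margin `m/12`).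
[cite: KohlerSchindlerTassion2023, Lemma 3 (proof, §4.2)] -/
theorem quasi_of_events (hTL : TopSideToLeftMeetsTB) (hTR : TopSideToRightMeetsTB)
    (hAlt : AlternatingTBMeet) (hCo : CorridorA) {ω : BondConfig (Site 2)}
    (hω : ω ⊆ (zdGraph 2).edgeSet) {m p t k n₂ n₃ : ℕ} (hm : m = 1536 * p) (hn₂ : n₂ = 3840 * p)
    (hn₃ : n₃ = 5952 * p) (hp : 0 < p) (hkp : k ≤ p) (htp : t < 12 * p)
    (h₁ : ω ∈ openCrossing
      (Site.shift ((p : ℤ) • ![-96, 0]) '' rect (-((m : ℤ) + (m / 64 : ℕ)) - t) (m + (m / 64 : ℕ)) (-(m : ℤ) - t) m)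
      (Site.shift ((p : ℤ) • ![-96, 0]) '' upperTarget t (m / 64) m)
      (Site.shift ((p : ℤ) • ![-96, 0]) '' upperTarget t (m / 64) (-(m : ℤ) - t)))
    (h₂ : ω ∈ openCrossing
      (Site.shift ((p : ℤ) • ![96, 0]) '' rect (-((m : ℤ) + (m / 64 : ℕ)) - t) (m + (m / 64 : ℕ)) (-(m : ℤ) - t) m)
      (Site.shift ((p : ℤ) • ![96, 0]) '' upperTarget t (m / 64) m)
      (Site.shift ((p : ℤ) • ![96, 0]) '' upperTarget t (m / 64) (-(m : ℤ) - t)))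
    (h₃ : ω ∈ openCrossing
      (Site.shift ((p : ℤ) • ![0, 2304]) '' rect (-((n₂ : ℤ) + (n₂ / 64 : ℕ)) - t) (n₂ + (n₂ / 64 : ℕ)) (-(n₂ : ℤ) - t) n₂)
      (Site.shift ((p : ℤ) • ![0, 2304]) '' upperTarget t (n₂ / 64) n₂)
      (Site.shift ((p : ℤ) • ![0, 2304]) '' upperTarget t (n₂ / 64) (-(n₂ : ℤ) - t)))
    (h₄ : ω ∈ openCrossing
      (Site.shift ((p : ℤ) • ![0, -2304]) '' rect (-((n₂ : ℤ) + (n₂ / 64 : ℕ)) - t) (n₂ + (n₂ / 64 : ℕ)) (-(n₂ : ℤ) - t) n₂)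
      (Site.shift ((p : ℤ) • ![0, -2304]) '' upperTarget t (n₂ / 64) n₂)
      (Site.shift ((p : ℤ) • ![0, -2304]) '' upperTarget t (n₂ / 64) (-(n₂ : ℤ) - t)))
    (h₅ : ω ∈ openCrossing
      (Site.shift ((p : ℤ) • ![-1729, 0]) ''
        (transposeEquiv '' rect (-((n₃ : ℤ) + (n₃ / 64 : ℕ)) - t) (n₃ + (n₃ / 64 : ℕ)) (-(n₃ : ℤ) - t) n₃))
      (Site.shift ((p : ℤ) • ![-1729, 0]) '' (transposeEquiv '' upperTarget t (n₃ / 64) n₃))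
      (Site.shift ((p : ℤ) • ![-1729, 0]) '' (transposeEquiv '' upperTarget t (n₃ / 64) (-(n₃ : ℤ) - t))))
    (h₆ : ω ∈ openCrossing
      (Site.shift ((p : ℤ) • ![1729, 0]) ''
        (transposeEquiv '' rect (-((n₃ : ℤ) + (n₃ / 64 : ℕ)) - t) (n₃ + (n₃ / 64 : ℕ)) (-(n₃ : ℤ) - t) n₃))
      (Site.shift ((p : ℤ) • ![1729, 0]) '' (transposeEquiv '' upperTarget t (n₃ / 64) n₃))
      (Site.shift ((p : ℤ) • ![1729, 0]) '' (transposeEquiv '' upperTarget t (n₃ / 64) (-(n₃ : ℤ) - t)))) :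
    ω ∈ quasi t (m + k) (4 * m) (m / 12) m :=
  quasiSides_of_arms hTL hTR hAlt hCo hω (bb := m / 12) (by omega) (by omega)
    (L := -(3900 * (p : ℤ)) - t) (R := 3900 * p)
    (L' := -(((4 * m : ℕ) : ℤ) + ((m + k : ℕ) : ℤ)) - t) (R' := ((4 * m : ℕ) : ℤ) + ((m + k : ℕ) : ℤ))
    (B₀ := -((4 * m : ℕ) : ℤ) - t) (T₀ := ((4 * m : ℕ) : ℤ)) (eL := -(72 * (p : ℤ)))
    (eR := 72 * (p : ℤ) - t) (by push_cast; omega) (by push_cast; omega) (by push_cast; omega)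
    (by push_cast; omega) (by push_cast; omega) (by push_cast; omega)
    (fenceLeft_of_event hm h₁) (fenceRight_of_event hm h₂) (longArmTop_of_event hm hn₂ htp h₃)
    (longArmBot_of_event hm hn₂ htp h₄) (crosserLeft_of_event hω hm hn₃ hkp h₅)
    (crosserRight_of_event hω hm hn₃ hkp h₆)

/-! ### Probability -/

variable {k t : ℕ} {μ : Measure (BondConfig (Site 2))}

/-- A translated arm event is as likely as the arm event. [cite: KohlerSchindlerTassion2023, §1 Symmetries] -/
theorem le_real_shift_arm {v : Site 2} (hv : μ.map (KST2023.act (Site.shift v)) = μ) {a₀ : ℝ}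
    {t α n : ℕ} (h : a₀ ≤ μ.real (arm t α n)) :
    a₀ ≤ μ.real (openCrossing (Site.shift v '' rect (-((n : ℤ) + α) - t) (n + α) (-(n : ℤ) - t) n)
      (Site.shift v '' upperTarget t α n) (Site.shift v '' upperTarget t α (-(n : ℤ) - t))) := by
  rw [real_openCrossing_image hv]
  exact h

/-- A translated transposed arm event is as likely as the arm event.
[cite: KohlerSchindlerTassion2023, §1 Symmetries] -/
theorem le_real_shift_transpose_arm (hT : μ.map (KST2023.act transposeEquiv) = μ) {v : Site 2}
    (hv : μ.map (KST2023.act (Site.shift v)) = μ) {a₀ : ℝ} {t α n : ℕ} (h : a₀ ≤ μ.real (arm t α n)) :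
    a₀ ≤ μ.real (openCrossing
      (Site.shift v '' (transposeEquiv '' rect (-((n : ℤ) + α) - t) (n + α) (-(n : ℤ) - t) n))
      (Site.shift v '' (transposeEquiv '' upperTarget t α n))
      (Site.shift v '' (transposeEquiv '' upperTarget t α (-(n : ℤ) - t)))) := by
  rw [real_openCrossing_image hv, real_openCrossing_image hT]
  exact h

/-- FKG over six increasing measurable events each of probability `≥ a₀`, followed by an almost
sure inclusion: `a₀ ^ 6 ≤ μ(Q)`. [cite: KohlerSchindlerTassion2023, §1 Positive association] -/
theorem pow_six_le_real' [IsProbabilityMeasure μ] (hμ : Admissible k t μ) (hL : LatticeCarried μ)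
    {a₀ : ℝ} (ha₀ : 0 ≤ a₀) {E : Fin 6 → Set (BondConfig (Site 2))} (hU : ∀ i, IsUpperSet (E i))
    (hM : ∀ i, MeasurableSet (E i)) (hb : ∀ i, a₀ ≤ μ.real (E i)) {Q : Set (BondConfig (Site 2))}
    (hQ : ∀ ω : BondConfig (Site 2), ω ⊆ (zdGraph 2).edgeSet → (∀ i, ω ∈ E i) → ω ∈ Q) :
    a₀ ^ 6 ≤ μ.real Q := by
  have h1 : a₀ ^ 6 ≤ ∏ i ∈ (Finset.univ : Finset (Fin 6)), μ.real (E i) := by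
    calc a₀ ^ 6 = ∏ _i ∈ (Finset.univ : Finset (Fin 6)), a₀ := by simp
      _ ≤ ∏ i ∈ (Finset.univ : Finset (Fin 6)), μ.real (E i) :=
          Finset.prod_le_prod (fun i _ => ha₀) fun i _ => hb i
  have h2 := prod_le_real_iInter hμ (Finset.univ : Finset (Fin 6)) (E := E) (fun i _ => hU i)
    fun i _ => hM i
  refine h1.trans (h2.trans (ENNReal.toReal_mono (measure_ne_top _ _) (measure_mono_ae ?_)))
  filter_upwards [hL] with ω hω h
  exact hQ ω hω fun i => Set.mem_iInter₂.1 h i (Finset.mem_univ i)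

/-- FKG over six open crossing events each of probability `≥ a₀`, followed by an almost sure
inclusion: `a₀ ^ 6 ≤ μ(Q)`. [cite: KohlerSchindlerTassion2023, §1 Positive association] -/
theorem pow_six_le_real [IsProbabilityMeasure μ] (hμ : Admissible k t μ) (hL : LatticeCarried μ)
    {a₀ : ℝ} (ha₀ : 0 ≤ a₀)
    {S₁ A₁ B₁ S₂ A₂ B₂ S₃ A₃ B₃ S₄ A₄ B₄ S₅ A₅ B₅ S₆ A₆ B₆ : Set (Site 2)}
    {Q : Set (BondConfig (Site 2))}
    (h₁ : a₀ ≤ μ.real (openCrossing S₁ A₁ B₁)) (h₂ : a₀ ≤ μ.real (openCrossing S₂ A₂ B₂))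
    (h₃ : a₀ ≤ μ.real (openCrossing S₃ A₃ B₃)) (h₄ : a₀ ≤ μ.real (openCrossing S₄ A₄ B₄))
    (h₅ : a₀ ≤ μ.real (openCrossing S₅ A₅ B₅)) (h₆ : a₀ ≤ μ.real (openCrossing S₆ A₆ B₆))
    (hQ : ∀ ω : BondConfig (Site 2), ω ⊆ (zdGraph 2).edgeSet → ω ∈ openCrossing S₁ A₁ B₁ →
      ω ∈ openCrossing S₂ A₂ B₂ → ω ∈ openCrossing S₃ A₃ B₃ → ω ∈ openCrossing S₄ A₄ B₄ →
      ω ∈ openCrossing S₅ A₅ B₅ → ω ∈ openCrossing S₆ A₆ B₆ → ω ∈ Q) :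
    a₀ ^ 6 ≤ μ.real Q := by
  refine pow_six_le_real' hμ hL ha₀ (E := ![openCrossing S₁ A₁ B₁, openCrossing S₂ A₂ B₂,
    openCrossing S₃ A₃ B₃, openCrossing S₄ A₄ B₄, openCrossing S₅ A₅ B₅, openCrossing S₆ A₆ B₆])
    ?_ ?_ ?_ ?_
  · intro i; fin_cases i <;> exact isUpperSet_openCrossing _ _ _
  · intro i; fin_cases i <;> exact measurableSet_openCrossing_of_countable _ _ _
  · intro i; fin_cases i; exacts [h₁, h₂, h₃, h₄, h₅, h₆]
  · intro ω hω h; exact hQ ω hω (h 0) (h 1) (h 2) (h 3) (h 4) (h 5)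

/-- **Lemma 3, weak periodic form** ([KohlerSchindlerTassion2023, Lemma 3 with Comment 1]): arm
bounds `μ(𝓐_t(n)) ≥ a₀` at all scales `n ≥ N₁` divisible by `64k` give
`μ(𝓠_t(4m, m)) ≥ a₀ ^ 6` at all scales `m ≥ N₁ + 128t + 1` divisible by `1536k` (big box
`R_t(5m + k, 4m)`, `m`-paths of margin `m/12`), for every admissible measure carried by lattice
configurations; granted `TopSideToLeftMeetsTB`, `TopSideToRightMeetsTB`, `AlternatingTBMeet` and
`CorridorA`. [cite: KohlerSchindlerTassion2023, Lemma 3 and Comment 1] -/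
theorem quasiOfArms_of (hTL : TopSideToLeftMeetsTB) (hTR : TopSideToRightMeetsTB)
    (hAlt : AlternatingTBMeet) (hCo : CorridorA) : QuasiOfArms k t := by
  intro a₀ ha₀ N₁
  refine ⟨a₀ ^ 6, by positivity, N₁ + 128 * t + 1, ?_⟩
  intro μ _ hμ hL harm m hmN hdiv
  obtain ⟨q, hq⟩ := hdiv
  obtain ⟨p, hp⟩ : ∃ p : ℕ, p = k * q := ⟨_, rfl⟩
  have hm : m = 1536 * p := by rw [hq, hp]; ring
  have hp0 : 0 < p := by omega
  have hq0 : 0 < q := Nat.pos_of_ne_zero fun h => by simp [h] at hp; omega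
  have hkp : k ≤ p := calc k ≤ k * q := Nat.le_mul_of_pos_right k hq0
    _ = p := hp.symm
  -- invariance under the translations of `pℤ²`
  have hshift : ∀ v : Site 2, μ.map (KST2023.act (Site.shift ((p : ℤ) • v))) = μ := by
    intro v
    have := hμ.shift_inv ((q : ℤ) • v)
    rwa [smul_smul, ← Nat.cast_mul, ← hp] at this
  -- the three arm bounds used
  have hA₁ : a₀ ≤ μ.real (arm t (m / 64) m) := harm m (by omega) ⟨24 * q, by rw [hq]; ring⟩
  have hA₂ : a₀ ≤ μ.real (arm t (3840 * p / 64) (3840 * p)) :=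
    harm (3840 * p) (by omega) ⟨60 * q, by rw [hp]; ring⟩
  have hA₃ : a₀ ≤ μ.real (arm t (5952 * p / 64) (5952 * p)) :=
    harm (5952 * p) (by omega) ⟨93 * q, by rw [hp]; ring⟩
  refine pow_six_le_real hμ hL ha₀.le (le_real_shift_arm (hshift ![-96, 0]) hA₁)
    (le_real_shift_arm (hshift ![96, 0]) hA₁) (le_real_shift_arm (hshift ![0, 2304]) hA₂)
    (le_real_shift_arm (hshift ![0, -2304]) hA₂)
    (le_real_shift_transpose_arm hμ.transpose_inv (hshift ![-1729, 0]) hA₃)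
    (le_real_shift_transpose_arm hμ.transpose_inv (hshift ![1729, 0]) hA₃) ?_
  intro ω hω h₁ h₂ h₃ h₄ h₅ h₆
  exact quasi_of_events hTL hTR hAlt hCo hω hm rfl rfl hp0 hkp (by omega) h₁ h₂ h₃ h₄ h₅ h₆

end KSTPeriodic

end

end Literature.Probability.Percolation
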